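import Literature.Topology.FourManifolds.KhAntiBigon
import Literature.Topology.FourManifolds.KhBigonD
import HarnessLib

/-!
# The unoriented resolution of the anti-parallel bigon is the old diagram

Sibling file of `KhBigonD.lean`, continuing `KhAntiBigon` (the bigon of the anti-parallel second
Reidemeister move `RMove.omega2c`) in the invariance programme for Khovanov homology and
Rasmussen's `s` under `GaussDiagram.REquiv`. In the resolution `stD' σ` of `G.antiBigon m ε` in
which NEITHER new chord is smoothed à la Seifert (the positive one at `1`, the negative one at
`0`), the two strands run straight through the bigon — for anti-parallel strands this is the
unoriented corner, see `KhAntiBigon` — and every state circle of `stD' σ` is a state circle of `σ`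
with two arcs subdivided, by the same chains of arcs as in the co-oriented case
(`inM' ~ sideE' ~ outM1'`, `inE' ~ sideM' ~ outE1'`), so that the projection `projDVal` of
`KhBigonD` serves verbatim. This file makes the identification `C(D_{10}) = C(D)` of
Khovanov (2000), §5.3 / Bar-Natan (2002), §4.3 explicit on generators, statement by statement as
in `KhBigonD.lean` (primed names):

* `projD'`, `liftD'` — the projection of the arcs of the bigon onto the arcs of `G` adapted to the
  unoriented resolution and a section; `circleOf_stD_eq_iff'` — **two arcs lie on one circle of
  `stD' σ` iff their projections lie on one circle of `σ`**;
* `antiD s` — the enhanced state of the bigon over `stD' s.state` with the labels of `s`;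
  `eq_antiD_of_state_eq` — every enhanced state over an unoriented resolution is of this form;
* `incidence_antiD` — **the differential restricted to the unoriented resolutions is the
  differential of `G`**: `⟨d (antiD s), antiD s'⟩ = ⟨d s, s'⟩`;
* `homDegree_antiD`, `qDegree_antiD` — the bidegree is unchanged (`|s| + 1`, `n₊ + 1`,
  `n₋ + 1`).

No named fact is introduced.

## References

* M. Khovanov, *A categorification of the Jones polynomial*, Duke Math. J. 101 (2000) 359–426,
  §5.3. [cite: Khovanov2000, §5.3]
* D. Bar-Natan, *On Khovanov's categorification of the Jones polynomial*, Algebr. Geom. Topol. 2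
  (2002) 337–370, §4.3. [cite: BarNatan2002, §4]
* M. Polyak, *Minimal generating sets of Reidemeister moves*, Quantum Topol. 1 (2010), Thm. 1.2
  (`Ω2c, Ω2d`). [cite: Polyak2010, Thm 1.2]
-/

open Function

noncomputable section

namespace Literature.Topology.FourManifolds

namespace GaussDiagram

variable (G : GaussDiagram) (m : Fin (2 * G.n + 1)) (ε : ℤˣ)

/-! ## The projection of arcs adapted to the unoriented resolution

The arithmetic (`midArc`, `projDVal`, `projDVal_lt`, `projDVal_eq_imp`) is that of `KhBigonD`. -/

/-- **The projection of the arcs of the antiBigon onto the arcs of `G`** adapted to the unoriented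
resolution. [folklore] -/
def projD' (x : (G.antiBigon m ε).Arc) : G.Arc := ⟨G.projDVal m x.val, G.projDVal_lt m x.val⟩

/-- The value of the projection. [folklore] -/
@[simp] theorem val_projD' (x : (G.antiBigon m ε).Arc) : (G.projD' m ε x : ℕ) = G.projDVal m x.val :=
  rfl

/-- **A section of the projection**: the old arc `q` lifts to the arc leaving the embedded old
point `q`. [folklore] -/
def liftD' (a : G.Arc) : (G.antiBigon m ε).Arc :=
  ⟨if a.val < m.val then a.val else a.val + 2, by
    have ha := a.isLt
    unfold arcCount at *
    rw [antiBigon_n]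
    split_ifs <;> omega⟩

/-- The value of the lift. [folklore] -/
@[simp] theorem val_liftD' (a : G.Arc) :
    (G.liftD' m ε a : ℕ) = if a.val < m.val then a.val else a.val + 2 := rfl

/-- The lift is a section of the projection. [folklore] -/
@[simp] theorem projD_liftD' (a : G.Arc) : G.projD' m ε (G.liftD' m ε a) = a := by
  apply Fin.ext
  have ha := a.isLt
  unfold arcCount at ha
  have hm := m.isLt
  simp only [val_projD', val_liftD', projDVal]
  split_ifs <;> omega

/-- The first side projects to `baseArc`. [folklore] -/
@[simp] theorem projD_sideM' : G.projD' m ε (G.sideM' m ε) = G.baseArc := by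
  apply Fin.ext; have hm := m.isLt; simp only [val_projD', val_sideM', projDVal, val_baseArc]
  split_ifs <;> omega

/-- The second side projects to `midArc`. [folklore] -/
@[simp] theorem projD_sideE' : G.projD' m ε (G.sideE' m ε) = G.midArc m := by
  apply Fin.ext; have hm := m.isLt; simp only [val_projD', val_sideE', projDVal, val_midArc]
  split_ifs <;> omega

/-- The arc leaving `m + 1` projects to `midArc`. [folklore] -/
@[simp] theorem projD_outM1' : G.projD' m ε (G.outM1' m ε) = G.midArc m := by
  apply Fin.ext; have hm := m.isLt; simp only [val_projD', val_outM1', projDVal, val_midArc]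
  split_ifs <;> omega

/-- The arc leaving `2n + 3` projects to `baseArc`. [folklore] -/
@[simp] theorem projD_outE1' : G.projD' m ε (G.outE1' m ε) = G.baseArc := by
  apply Fin.ext; have hm := m.isLt; simp only [val_projD', val_outE1', projDVal, val_baseArc]
  split_ifs <;> omega

/-- The arc entering `m` projects to `midArc`. [folklore] -/
@[simp] theorem projD_inM' : G.projD' m ε (G.inM' m ε) = G.midArc m := by
  apply Fin.ext; have hm := m.isLt; simp only [val_projD', val_inM', projDVal, val_midArc]
  split_ifs <;> omega

/-- The arc entering `2n + 2` projects to `baseArc`. [folklore] -/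
@[simp] theorem projD_inE' : G.projD' m ε (G.inE' m ε) = G.baseArc := by
  apply Fin.ext; have hm := m.isLt; simp only [val_projD', val_inE', projDVal, val_baseArc]
  split_ifs <;> omega

/-- The arc leaving an embedded old point projects to the old outgoing arc. [folklore] -/
@[simp] theorem projD_arcOut_bEmb' (q : Fin (2 * G.n)) :
    G.projD' m ε ((G.antiBigon m ε).arcOut (G.bEmb' m ε q)) = G.arcOut q := by
  apply Fin.ext
  have hm := m.isLt; have hq := q.isLt
  rw [val_projD', val_arcOut_bEmb', arcOut_val]
  unfold projDVal
  split_ifs <;> omega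

/-- The arc entering an embedded old point projects to the old incoming arc. [folklore] -/
@[simp] theorem projD_arcIn_bEmb' (q : Fin (2 * G.n)) :
    G.projD' m ε ((G.antiBigon m ε).arcIn (G.bEmb' m ε q)) = G.arcIn q := by
  apply Fin.ext
  have hm := m.isLt; have hq := q.isLt
  rw [val_projD', val_arcIn_bEmb', arcIn_val]
  unfold projDVal
  split_ifs <;> omega

/-- The lift of the old outgoing arc is the arc leaving the embedded old point. [folklore] -/
theorem liftD_arcOut' (q : Fin (2 * G.n)) :
    G.liftD' m ε (G.arcOut q) = (G.antiBigon m ε).arcOut (G.bEmb' m ε q) :=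
  Fin.ext rfl

/-! ## Gluings of the antiBigon at old points, projected -/

section Glue

variable (σ : G.State) (a b : Bool)

/-- The gluing clause of the antiBigon at an embedded old point. [folklore] -/
theorem glueRel_antiBigon_bEmb (q : Fin (2 * G.n)) (u v : (G.antiBigon m ε).Arc) :
    (G.antiBigon m ε).glueRel (G.antiState m ε σ a b) (G.bEmb' m ε q) u v ↔
      (G.isSeifert σ (G.chordOf q) = true ∧
          ((u = (G.antiBigon m ε).arcIn (G.bEmb' m ε q) ∧
              v = (G.antiBigon m ε).arcOut (G.bEmb' m ε (G.partner q))) ∨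
            (v = (G.antiBigon m ε).arcIn (G.bEmb' m ε q) ∧
              u = (G.antiBigon m ε).arcOut (G.bEmb' m ε (G.partner q))))) ∨
        (G.isSeifert σ (G.chordOf q) = false ∧
          ((u = (G.antiBigon m ε).arcIn (G.bEmb' m ε q) ∧
              v = (G.antiBigon m ε).arcIn (G.bEmb' m ε (G.partner q))) ∨
            (u = (G.antiBigon m ε).arcOut (G.bEmb' m ε q) ∧
              v = (G.antiBigon m ε).arcOut (G.bEmb' m ε (G.partner q))))) := by
  simp only [glueRel, chordOf_bEmb', isSeifert_antiBigon_oldC, partner_bEmb']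

/-- A gluing of the antiBigon at an old point projects to the corresponding gluing of `G`.
[folklore] -/
theorem glueRel_projD_of_bEmb' {q : Fin (2 * G.n)} {u v : (G.antiBigon m ε).Arc}
    (h : (G.antiBigon m ε).glueRel (G.antiState m ε σ a b) (G.bEmb' m ε q) u v) :
    G.glueRel σ q (G.projD' m ε u) (G.projD' m ε v) := by
  rw [glueRel_antiBigon_bEmb] at h
  unfold glueRel
  rcases h with ⟨hs, ⟨rfl, rfl⟩ | ⟨rfl, rfl⟩⟩ | ⟨hs, ⟨rfl, rfl⟩ | ⟨rfl, rfl⟩⟩ <;> simp [hs]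

/-- A gluing of `G` lifts to a gluing of the antiBigon at the corresponding old point, between arcs
with the given projections. [folklore] -/
theorem exists_glueRel_antiBigon_of_glueRel {q : Fin (2 * G.n)} {u₀ v₀ : G.Arc}
    (h : G.glueRel σ q u₀ v₀) :
    ∃ u v, (G.antiBigon m ε).glueRel (G.antiState m ε σ a b) (G.bEmb' m ε q) u v ∧
      G.projD' m ε u = u₀ ∧ G.projD' m ε v = v₀ := by
  unfold glueRel at h
  rcases h with ⟨hs, ⟨rfl, rfl⟩ | ⟨rfl, rfl⟩⟩ | ⟨hs, ⟨rfl, rfl⟩ | ⟨rfl, rfl⟩⟩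
  · exact ⟨_, _, (G.glueRel_antiBigon_bEmb m ε σ a b q _ _).2 (Or.inl ⟨hs, Or.inl ⟨rfl, rfl⟩⟩),
      by simp, by simp⟩
  · exact ⟨_, _, (G.glueRel_antiBigon_bEmb m ε σ a b q _ _).2 (Or.inl ⟨hs, Or.inr ⟨rfl, rfl⟩⟩),
      by simp, by simp⟩
  · exact ⟨_, _, (G.glueRel_antiBigon_bEmb m ε σ a b q _ _).2 (Or.inr ⟨hs, Or.inl ⟨rfl, rfl⟩⟩),
      by simp, by simp⟩
  · exact ⟨_, _, (G.glueRel_antiBigon_bEmb m ε σ a b q _ _).2 (Or.inr ⟨hs, Or.inr ⟨rfl, rfl⟩⟩),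
      by simp, by simp⟩

end Glue

/-! ## Reachability in the unoriented resolution -/

section Reach

variable (σ : G.State)

/-- In the unoriented resolution, a gluing at a new point relates two arcs with the same
projection (both sides of the antiBigon go with the strand they are glued into). [folklore] -/
theorem projD_eq_of_glueRel_stD_new' {p : Fin (2 * (G.antiBigon m ε).n)}
    (hp : p = G.posM' m ε ∨ p = G.posM1' m ε ∨ p = G.posE' m ε ∨ p = G.posE1' m ε)
    {u v : (G.antiBigon m ε).Arc} (h : (G.antiBigon m ε).glueRel (G.stD' m ε σ) p u v) :
    G.projD' m ε u = G.projD' m ε v := by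
  have hx := G.isSeifert_stD_bX' m ε σ
  have hy := G.isSeifert_stD_bY' m ε σ
  rcases hp with rfl | rfl | rfl | rfl
  · rw [glueRel_posM', hx] at h
    rcases h with ⟨h', -⟩ | ⟨-, ⟨rfl, rfl⟩ | ⟨rfl, rfl⟩⟩
    · exact Bool.noConfusion h'
    · rw [projD_inM', projD_sideE']
    · rw [projD_sideM', projD_outE1']
  · rw [glueRel_posM1', hy] at h
    rcases h with ⟨h', -⟩ | ⟨-, ⟨rfl, rfl⟩ | ⟨rfl, rfl⟩⟩
    · exact Bool.noConfusion h'
    · rw [projD_sideM', projD_inE']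
    · rw [projD_outM1', projD_sideE']
  · rw [glueRel_posE', hy] at h
    rcases h with ⟨h', -⟩ | ⟨-, ⟨rfl, rfl⟩ | ⟨rfl, rfl⟩⟩
    · exact Bool.noConfusion h'
    · rw [projD_inE', projD_sideM']
    · rw [projD_sideE', projD_outM1']
  · rw [glueRel_posE1', hx] at h
    rcases h with ⟨h', -⟩ | ⟨-, ⟨rfl, rfl⟩ | ⟨rfl, rfl⟩⟩
    · exact Bool.noConfusion h'
    · rw [projD_sideE', projD_inM']
    · rw [projD_outE1', projD_sideM']

/-- **Reachability in the unoriented resolution of the antiBigon projects to reachability in `G`.**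
[folklore] -/
theorem reachable_projD_stD' {u v : (G.antiBigon m ε).Arc}
    (h : ((G.antiBigon m ε).stateGraph (G.stD' m ε σ)).Reachable u v) :
    (G.stateGraph σ).Reachable (G.projD' m ε u) (G.projD' m ε v) := by
  obtain ⟨w⟩ := h
  induction w with
  | nil => rfl
  | @cons a c _ hadj _ ih =>
    refine SimpleGraph.Reachable.trans ?_ ih
    rw [stateGraph_adj] at hadj
    obtain ⟨-, p, hp⟩ := hadj
    rcases G.eq_bEmb_or' m ε p with ⟨q, rfl⟩ | hnew
    · rcases hp with hp | hp
      · exact G.reachable_of_glueRel σ (G.glueRel_projD_of_bEmb' m ε σ _ _ hp)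
      · exact (G.reachable_of_glueRel σ (G.glueRel_projD_of_bEmb' m ε σ _ _ hp)).symm
    · rcases hp with hp | hp
      · rw [G.projD_eq_of_glueRel_stD_new' m ε σ hnew hp]
      · rw [G.projD_eq_of_glueRel_stD_new' m ε σ hnew hp]

/-- In the unoriented resolution the arc entering `m` is glued to the second side (at `m`, where
`x` is not Seifert: `arcIn m ~ arcIn (2n + 3)`). [folklore] -/
theorem adj_stD_inM_sideE' :
    ((G.antiBigon m ε).stateGraph (G.stD' m ε σ)).Reachable (G.inM' m ε) (G.sideE' m ε) :=
  (G.antiBigon m ε).reachable_of_glueRel _ ((G.glueRel_posM' m ε _ _ _).2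
    (Or.inr ⟨G.isSeifert_stD_bX' m ε σ, Or.inl ⟨rfl, rfl⟩⟩))

/-- In the unoriented resolution the second side is glued to the arc leaving `m + 1` (at `2n + 2`,
where `y` is not Seifert: `arcOut (2n + 2) ~ arcOut (m + 1)`). [folklore] -/
theorem adj_stD_sideE_outM1' :
    ((G.antiBigon m ε).stateGraph (G.stD' m ε σ)).Reachable (G.sideE' m ε) (G.outM1' m ε) :=
  (G.antiBigon m ε).reachable_of_glueRel _ ((G.glueRel_posE' m ε _ _ _).2
    (Or.inr ⟨G.isSeifert_stD_bY' m ε σ, Or.inr ⟨rfl, rfl⟩⟩))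

/-- In the unoriented resolution the arc entering `2n + 2` is glued to the first side (at `2n + 2`:
`arcIn (2n + 2) ~ arcIn (m + 1)`). [folklore] -/
theorem adj_stD_inE_sideM' :
    ((G.antiBigon m ε).stateGraph (G.stD' m ε σ)).Reachable (G.inE' m ε) (G.sideM' m ε) :=
  (G.antiBigon m ε).reachable_of_glueRel _ ((G.glueRel_posE' m ε _ _ _).2
    (Or.inr ⟨G.isSeifert_stD_bY' m ε σ, Or.inl ⟨rfl, rfl⟩⟩))

/-- In the unoriented resolution the first side is glued to the arc leaving `2n + 3` (at `m`:
`arcOut m ~ arcOut (2n + 3)`). [folklore] -/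
theorem adj_stD_sideM_outE1' :
    ((G.antiBigon m ε).stateGraph (G.stD' m ε σ)).Reachable (G.sideM' m ε) (G.outE1' m ε) :=
  (G.antiBigon m ε).reachable_of_glueRel _ ((G.glueRel_posM' m ε _ _ _).2
    (Or.inr ⟨G.isSeifert_stD_bX' m ε σ, Or.inr ⟨rfl, rfl⟩⟩))

/-- An arc among `{inM', sideE', outM1'}` lies on the circle of the second side. [folklore] -/
theorem reachable_stD_sideE_of_val' {u : (G.antiBigon m ε).Arc}
    (hu : u.val = (if m.val = 0 then 2 * G.n + 3 else m.val - 1) ∨ u.val = 2 * G.n + 2 ∨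
      u.val = m.val + 1) :
    ((G.antiBigon m ε).stateGraph (G.stD' m ε σ)).Reachable u (G.sideE' m ε) := by
  rcases hu with hu | hu | hu
  · rw [show u = G.inM' m ε from Fin.ext (by rw [hu, val_inM'])]
    exact G.adj_stD_inM_sideE' m ε σ
  · rw [show u = G.sideE' m ε from Fin.ext hu]
  · rw [show u = G.outM1' m ε from Fin.ext hu]
    exact (G.adj_stD_sideE_outM1' m ε σ).symm

/-- An arc among `{inE', sideM', outE1'}` lies on the circle of the first side. [folklore] -/
theorem reachable_stD_sideM_of_val' {u : (G.antiBigon m ε).Arc}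
    (hu : u.val = 2 * G.n + 1 ∨ u.val = m.val ∨ u.val = 2 * G.n + 3) :
    ((G.antiBigon m ε).stateGraph (G.stD' m ε σ)).Reachable u (G.sideM' m ε) := by
  rcases hu with hu | hu | hu
  · rw [show u = G.inE' m ε from Fin.ext (by rw [hu, val_inE'])]
    exact G.adj_stD_inE_sideM' m ε σ
  · rw [show u = G.sideM' m ε from Fin.ext hu]
  · rw [show u = G.outE1' m ε from Fin.ext hu]
    exact (G.adj_stD_sideM_outE1' m ε σ).symm

/-- When both pairs of new points subdivide the same old arc, the two sides lie on one circle of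
the unoriented resolution. [folklore] -/
theorem reachable_stD_sideM_sideE' (hm : m.val = 0 ∨ m.val = 2 * G.n) :
    ((G.antiBigon m ε).stateGraph (G.stD' m ε σ)).Reachable (G.sideM' m ε) (G.sideE' m ε) := by
  rcases hm with hm | hm
  · -- `m = 0`: the arc leaving `2n + 3` is the arc entering `m`
    have e : G.outE1' m ε = G.inM' m ε := Fin.ext (by rw [val_outE1', val_inM', if_pos hm])
    have h1 := G.adj_stD_sideM_outE1' m ε σ
    rw [e] at h1
    exact h1.trans (G.adj_stD_inM_sideE' m ε σ)
  · -- `m = 2n`: the arc leaving `m + 1` is the arc entering `2n + 2`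
    have e : G.outM1' m ε = G.inE' m ε := Fin.ext (by rw [val_outM1', val_inE', hm])
    have h1 := G.adj_stD_sideE_outM1' m ε σ
    rw [e] at h1
    exact (h1.trans (G.adj_stD_inE_sideM' m ε σ)).symm

/-- **Arcs with the same projection lie on one circle of the unoriented resolution.** [folklore] -/
theorem reachable_stD_of_projD_eq' {u v : (G.antiBigon m ε).Arc}
    (h : G.projD' m ε u = G.projD' m ε v) :
    ((G.antiBigon m ε).stateGraph (G.stD' m ε σ)).Reachable u v := by
  have hu : u.val < 2 * G.n + 4 := lt_of_lt_of_eq u.isLt (G.arcCount_antiBigon m ε)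
  have hv : v.val < 2 * G.n + 4 := lt_of_lt_of_eq v.isLt (G.arcCount_antiBigon m ε)
  rcases G.projDVal_eq_imp m hu hv (congrArg Fin.val h) with
    huv | ⟨hu', hv'⟩ | ⟨hu', hv'⟩ | ⟨hm, hu', hv'⟩
  · rw [Fin.ext huv]
  · exact (G.reachable_stD_sideE_of_val' m ε σ hu').trans
      (G.reachable_stD_sideE_of_val' m ε σ hv').symm
  · exact (G.reachable_stD_sideM_of_val' m ε σ hu').trans
      (G.reachable_stD_sideM_of_val' m ε σ hv').symm
  · have key : ∀ w : (G.antiBigon m ε).Arc,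
        (w.val = 2 * G.n + 1 ∨ w.val = m.val ∨ w.val = 2 * G.n + 3 ∨ w.val = 2 * G.n + 2 ∨
          w.val = m.val + 1 ∨ w.val = (if m.val = 0 then 2 * G.n + 3 else m.val - 1)) →
        ((G.antiBigon m ε).stateGraph (G.stD' m ε σ)).Reachable w (G.sideM' m ε) := by
      intro w hw
      rcases hw with hw | hw | hw | hw | hw | hw
      · exact G.reachable_stD_sideM_of_val' m ε σ (Or.inl hw)
      · exact G.reachable_stD_sideM_of_val' m ε σ (Or.inr (Or.inl hw))
      · exact G.reachable_stD_sideM_of_val' m ε σ (Or.inr (Or.inr hw))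
      · exact (G.reachable_stD_sideE_of_val' m ε σ (Or.inr (Or.inl hw))).trans
          (G.reachable_stD_sideM_sideE' m ε σ hm).symm
      · exact (G.reachable_stD_sideE_of_val' m ε σ (Or.inr (Or.inr hw))).trans
          (G.reachable_stD_sideM_sideE' m ε σ hm).symm
      · exact (G.reachable_stD_sideE_of_val' m ε σ (Or.inl hw)).trans
          (G.reachable_stD_sideM_sideE' m ε σ hm).symm
    exact (key u hu').trans (key v hv').symm

/-- **Reachability in `G` lifts to the unoriented resolution of the antiBigon**, between any arcs with
the given projections. [folklore] -/
theorem reachable_stD_of_reachable' {u₀ v₀ : G.Arc} (h : (G.stateGraph σ).Reachable u₀ v₀)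
    {u v : (G.antiBigon m ε).Arc} (hu : G.projD' m ε u = u₀) (hv : G.projD' m ε v = v₀) :
    ((G.antiBigon m ε).stateGraph (G.stD' m ε σ)).Reachable u v := by
  obtain ⟨w⟩ := h
  induction w generalizing u with
  | nil => exact G.reachable_stD_of_projD_eq' m ε σ (hu.trans hv.symm)
  | @cons a c _ hadj _ ih =>
    rw [stateGraph_adj] at hadj
    obtain ⟨-, q, hq⟩ := hadj
    have key : ∃ u' c', ((G.antiBigon m ε).stateGraph (G.stD' m ε σ)).Reachable u' c' ∧
        G.projD' m ε u' = a ∧ G.projD' m ε c' = c := by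
      rcases hq with hq | hq
      · obtain ⟨u', c', hg, h1, h2⟩ := G.exists_glueRel_antiBigon_of_glueRel m ε σ _ _ hq
        exact ⟨u', c', (G.antiBigon m ε).reachable_of_glueRel _ hg, h1, h2⟩
      · obtain ⟨c', u', hg, h1, h2⟩ := G.exists_glueRel_antiBigon_of_glueRel m ε σ _ _ hq
        exact ⟨u', c', ((G.antiBigon m ε).reachable_of_glueRel _ hg).symm, h2, h1⟩
    obtain ⟨u', c', hr, h1, h2⟩ := key
    exact ((G.reachable_stD_of_projD_eq' m ε σ (hu.trans h1.symm)).trans hr).trans (ih h2 hv)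

/-- **State circles of the unoriented resolution of the antiBigon are those of `G`**: two arcs lie on
one circle of `stD' σ` iff their projections lie on one circle of `σ`. Khovanov (2000), §5.3
(`D_{01} = D`); Bar-Natan (2002), §4.3. [cite: Khovanov2000, §5.3] -/
theorem circleOf_stD_eq_iff' (u v : (G.antiBigon m ε).Arc) :
    (G.antiBigon m ε).circleOf (G.stD' m ε σ) u = (G.antiBigon m ε).circleOf (G.stD' m ε σ) v ↔
      G.circleOf σ (G.projD' m ε u) = G.circleOf σ (G.projD' m ε v) := by
  simp only [circleOf_eq_iff]
  exact ⟨G.reachable_projD_stD' m ε σ, fun h ↦ G.reachable_stD_of_reachable' m ε σ h rfl rfl⟩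

/-- **The state circles of the unoriented resolution, as a type, are those of `G`.** [folklore] -/
def stDCircleEquiv' : (G.antiBigon m ε).StateCircle (G.stD' m ε σ) ≃ G.StateCircle σ where
  toFun := SimpleGraph.ConnectedComponent.lift (fun u ↦ G.circleOf σ (G.projD' m ε u))
    (fun _ _ p _ ↦ circleOf_eq_iff.2 (G.reachable_projD_stD' m ε σ ⟨p⟩))
  invFun := SimpleGraph.ConnectedComponent.lift
    (fun a ↦ (G.antiBigon m ε).circleOf (G.stD' m ε σ) (G.liftD' m ε a))
    (fun a b p _ ↦ circleOf_eq_iff.2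
      (G.reachable_stD_of_reachable' m ε σ ⟨p⟩ (G.projD_liftD' m ε a) (G.projD_liftD' m ε b)))
  left_inv C' := by
    induction C' using SimpleGraph.ConnectedComponent.ind with | h u => ?_
    change (G.antiBigon m ε).circleOf _ (G.liftD' m ε (G.projD' m ε u)) =
      (G.antiBigon m ε).circleOf _ u
    exact circleOf_eq_iff.2 (G.reachable_stD_of_projD_eq' m ε σ (G.projD_liftD' m ε _))
  right_inv C := by
    induction C using SimpleGraph.ConnectedComponent.ind with | h a => ?_
    change G.circleOf σ (G.projD' m ε (G.liftD' m ε a)) = G.circleOf σ a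
    rw [projD_liftD']

/-- `stDCircleEquiv'` sends the circle of an arc to the circle of its projection. [folklore] -/
@[simp] theorem stDCircleEquiv_circleOf' (u : (G.antiBigon m ε).Arc) :
    G.stDCircleEquiv' m ε σ ((G.antiBigon m ε).circleOf (G.stD' m ε σ) u) =
      G.circleOf σ (G.projD' m ε u) := rfl

end Reach

/-! ## Enhanced states over the unoriented resolution -/

variable {G}

/-- **The enhanced state of the antiBigon over the unoriented resolution with the labels of `s`**
(every arc labelled as its projection): the generator of `C(D_{01}) = C(D)` corresponding to the
generator `s` of `C(D)`. Khovanov (2000), §5.3; Bar-Natan (2002), §4.3. [cite: Khovanov2000, §5.3] -/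
def antiD (s : G.EnhancedState) : (G.antiBigon m ε).EnhancedState where
  state := G.stD' m ε s.state
  label u := s.label (G.projD' m ε u)
  label_eq _ _ huv :=
    s.label_eq_of_reachable (G.reachable_projD_stD' m ε s.state huv.reachable)

/-- The state of `antiD s`. [folklore] -/
@[simp] theorem antiD_state (s : G.EnhancedState) : (antiD m ε s).state = G.stD' m ε s.state :=
  rfl

/-- The labels of `antiD s`. [folklore] -/
@[simp] theorem antiD_label (s : G.EnhancedState) (u : (G.antiBigon m ε).Arc) :
    (antiD m ε s).label u = s.label (G.projD' m ε u) := rfl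

/-- **The inverse construction**: from an enhanced state of the antiBigon over an unoriented resolution,
the enhanced state of `G` with the labels read on the lifts. [folklore] -/
def unantiD (t : (G.antiBigon m ε).EnhancedState) {σ : G.State} (ht : t.state = G.stD' m ε σ) :
    G.EnhancedState where
  state := σ
  label a := t.label (G.liftD' m ε a)
  label_eq a b hab := by
    apply t.label_eq_of_reachable
    rw [ht]
    exact G.reachable_stD_of_reachable' m ε σ hab.reachable (G.projD_liftD' m ε a)
      (G.projD_liftD' m ε b)

/-- `unantiD` is a left inverse of `antiD`. [folklore] -/
theorem unantiD_antiD (s : G.EnhancedState) : unantiD m ε (antiD m ε s) rfl = s :=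
  EnhancedState.ext' rfl (funext fun a ↦ by simp [unantiD])

/-- `antiD` is a left inverse of `unantiD`: **every enhanced state over an unoriented resolution
is a `antiD`**. [folklore] -/
theorem antiD_unantiD (t : (G.antiBigon m ε).EnhancedState) {σ : G.State}
    (ht : t.state = G.stD' m ε σ) : antiD m ε (unantiD m ε t ht) = t := by
  refine EnhancedState.ext' ht.symm (funext fun u ↦ ?_)
  show t.label (G.liftD' m ε (G.projD' m ε u)) = t.label u
  apply t.label_eq_of_reachable
  rw [ht]
  exact G.reachable_stD_of_projD_eq' m ε σ (G.projD_liftD' m ε _)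

/-- Every enhanced state over an unoriented resolution is a `antiD`. [folklore] -/
theorem eq_antiD_of_state_eq (t : (G.antiBigon m ε).EnhancedState) {σ : G.State}
    (ht : t.state = G.stD' m ε σ) : ∃ s : G.EnhancedState, s.state = σ ∧ antiD m ε s = t :=
  ⟨unantiD m ε t ht, rfl, antiD_unantiD m ε t ht⟩

/-- `antiD` is injective. [folklore] -/
theorem antiD_injective : Injective (antiD m ε (G := G)) := fun s s' h ↦ by
  have hst : s.state = s'.state :=
    (G.antiState_inj m ε (congrArg EnhancedState.state h :)).1
  refine EnhancedState.ext' hst (funext fun a ↦ ?_)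
  have := congrArg (fun t : (G.antiBigon m ε).EnhancedState ↦ t.label (G.liftD' m ε a)) h
  simpa using this

/-- `antiD` is injective, as an iff. [folklore] -/
@[simp] theorem antiD_eq_iff {s s' : G.EnhancedState} : antiD m ε s = antiD m ε s' ↔ s = s' :=
  (antiD_injective m ε).eq_iff

/-! ## Merges, splits and incidence numbers over the unoriented resolution -/

/-- The first local strand of an old chord in the antiBigon projects to the old first strand.
[folklore] -/
theorem projD_arcIn_overPos_oldC' (i : Fin G.n) :
    G.projD' m ε ((G.antiBigon m ε).arcIn ((G.antiBigon m ε).overPos (G.oldC' m ε i))) =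
      G.arcIn (G.overPos i) := by
  rw [overPos_antiBigon_oldC, projD_arcIn_bEmb']

/-- The second local strand of an old chord in the antiBigon projects to the old second strand.
[folklore] -/
theorem projD_arcOut_overPos_oldC' (i : Fin G.n) :
    G.projD' m ε ((G.antiBigon m ε).arcOut ((G.antiBigon m ε).overPos (G.oldC' m ε i))) =
      G.arcOut (G.overPos i) := by
  rw [overPos_antiBigon_oldC, projD_arcOut_bEmb']

/-- Flipping an old chord of an unoriented resolution gives an unoriented resolution. [folklore] -/
theorem update_stD_oldC' (σ : G.State) (i : Fin G.n) (c : Bool) :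
    Function.update (G.stD' m ε σ) (G.oldC' m ε i) c = G.stD' m ε (Function.update σ i c) :=
  G.update_antiState_oldC m ε σ _ _ i c

/-- An oriented resolution at an old chord. [folklore] -/
@[simp] theorem stD_oldC' (σ : G.State) (i : Fin G.n) : G.stD' m ε σ (G.oldC' m ε i) = σ i :=
  G.antiState_oldC m ε σ _ _ i

/-- **An old chord is a merge in the unoriented resolution of the antiBigon iff it is a merge in `G`.**
[folklore] -/
theorem isMergeAt_stD_oldC_iff' (σ : G.State) (i : Fin G.n) :
    (G.antiBigon m ε).IsMergeAt (G.stD' m ε σ) (G.oldC' m ε i) ↔ G.IsMergeAt σ i := by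
  unfold IsMergeAt
  rw [stD_oldC', Ne, circleOf_stD_eq_iff', projD_arcIn_overPos_oldC', projD_arcOut_overPos_oldC']

/-- **An old chord is a split in the unoriented resolution of the antiBigon iff it is a split in `G`.**
[folklore] -/
theorem isSplitAt_stD_oldC_iff' (σ : G.State) (i : Fin G.n) :
    (G.antiBigon m ε).IsSplitAt (G.stD' m ε σ) (G.oldC' m ε i) ↔ G.IsSplitAt σ i := by
  unfold IsSplitAt
  rw [stD_oldC', update_stD_oldC', Ne, circleOf_stD_eq_iff', projD_arcIn_overPos_oldC',
    projD_arcOut_overPos_oldC']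

/-- The agreement clause of the incidence number, transported along the projection. [folklore] -/
theorem forall_label_stD_iff' (s s' : G.EnhancedState) (τ : G.State) (a : G.Arc)
    (a' : (G.antiBigon m ε).Arc) (ha : G.projD' m ε a' = a) :
    (∀ c, (G.antiBigon m ε).circleOf (G.stD' m ε τ) c ≠
        (G.antiBigon m ε).circleOf (G.stD' m ε τ) a' →
        s'.label (G.projD' m ε c) = s.label (G.projD' m ε c)) ↔
      ∀ c, G.circleOf τ c ≠ G.circleOf τ a → s'.label c = s.label c := by
  constructor
  · intro H c hc
    have := H (G.liftD' m ε c) (by rw [Ne, circleOf_stD_eq_iff', projD_liftD', ha]; exact hc)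
    simpa using this
  · intro H c hc
    exact H _ (by rw [Ne, circleOf_stD_eq_iff', ha] at hc; exact hc)

/-- The Koszul sign of an old chord in an unoriented resolution. [folklore] -/
theorem edgeSign_stD_oldC' (σ : G.State) (i : Fin G.n) :
    edgeSign (G.stD' m ε σ) (G.oldC' m ε i) = edgeSign σ i :=
  G.edgeSign_antiState_oldC m ε σ _ _ i

section Ring

variable {R : Type} [CommRing R] (hR tR : R)

/-- **The differential of the antiBigon restricted to the unoriented resolutions is the differential of
`G`**: `⟨d (antiD s), antiD s'⟩ = ⟨d s, s'⟩` — old chords are merges/splits in the oriented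
resolution exactly when they are in `G`, with the same local strands, the same labels and the
same Koszul signs. Khovanov (2000), §5.3 (`C(D_{01}) = C(D)`); Bar-Natan (2002), §4.3.
[cite: Khovanov2000, §5.3] -/
theorem incidence_antiD (s s' : G.EnhancedState) :
    (G.antiBigon m ε).incidence R hR tR (antiD m ε s) (antiD m ε s') =
      G.incidence R hR tR s s' := by
  by_cases hfl : ∃ i, s.state i = false ∧ s'.state = Function.update s.state i true
  · obtain ⟨i, hi, hs'⟩ := hfl
    have hi' : (antiD m ε s).state (G.oldC' m ε i) = false := by simpa using hi
    have hs'' : (antiD m ε s').state =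
        Function.update (antiD m ε s).state (G.oldC' m ε i) true := by
      simp only [antiD_state, update_stD_oldC', hs']
    rw [(G.antiBigon m ε).incidence_of_flip R hR tR hi' hs'', G.incidence_of_flip R hR tR hi hs']
    have e1 := forall_label_stD_iff' m ε s s' s'.state (G.arcIn (G.overPos i)) _
      (projD_arcIn_overPos_oldC' m ε i)
    have e2 := forall_label_stD_iff' m ε s s' s.state (G.arcIn (G.overPos i)) _
      (projD_arcIn_overPos_oldC' m ε i)
    simp only [antiD_state, isMergeAt_stD_oldC_iff', isSplitAt_stD_oldC_iff', edgeSign_stD_oldC',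
      antiD_label, projD_arcIn_overPos_oldC', projD_arcOut_overPos_oldC', e1, e2]
  · rw [G.incidence_of_not_flip R hR tR hfl, (G.antiBigon m ε).incidence_of_not_flip R hR tR]
    rintro ⟨j, hj, hj'⟩
    apply hfl
    rcases G.eq_oldC_or_bX_or_bY' m ε j with ⟨i, rfl⟩ | rfl | rfl
    · refine ⟨i, by simpa using hj, ?_⟩
      simp only [antiD_state, update_stD_oldC'] at hj'
      exact (G.antiState_inj m ε hj').1
    · simp only [antiD_state, stD', update_antiState_bX] at hj'
      have := (G.antiState_inj m ε hj').2.1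
      simp only [antiD_state, stD', antiState_bX] at hj
      rw [hj] at this
      exact (Bool.false_ne_true this).elim
    · simp only [antiD_state, stD', update_antiState_bY] at hj'
      have := (G.antiState_inj m ε hj').2.2
      simp only [antiD_state, stD', antiState_bY] at hj
      rw [hj] at this
      exact (Bool.false_ne_true this).elim

end Ring

/-! ## Degrees -/

/-- The weight of an unoriented resolution: one of the two new chords is `1`-smoothed. [folklore] -/
theorem weight_stD' (σ : G.State) : (G.stD' m ε σ).weight = σ.weight + 1 := by
  unfold stD' oBitX oBitY
  rw [weight_antiState]
  rcases Int.units_eq_one_or ε with rfl | rfl <;> simp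

/-- **`antiD` preserves the homological degree** (`|s| + 1` and `n₋ + 1`). Khovanov (2000), §5.3.
[cite: Khovanov2000, §5.3] -/
theorem homDegree_antiD (s : G.EnhancedState) : homDegree (antiD m ε s) = homDegree s := by
  simp only [homDegree, antiD_state, weight_stD', nMinus_antiBigon]
  push_cast
  ring

/-- The labels of the circles of `antiD s` are those of `s`. [folklore] -/
theorem circleLabel_antiD (s : G.EnhancedState)
    (C' : (G.antiBigon m ε).StateCircle (antiD m ε s).state) :
    circleLabel (antiD m ε s) C' = circleLabel s (G.stDCircleEquiv' m ε s.state C') := by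
  induction C' using SimpleGraph.ConnectedComponent.ind with | h u => ?_
  rfl

/-- **`antiD` preserves the quantum degree** (the labelled circles correspond; `|s| + 1`,
`n₊ + 1`, `n₋ + 1`). Khovanov (2000), §5.3. [cite: Khovanov2000, §5.3] -/
theorem qDegree_antiD (s : G.EnhancedState) : qDegree (antiD m ε s) = qDegree s := by
  have hsum : ∑ C', labelDeg (circleLabel (antiD m ε s) C') = ∑ C, labelDeg (circleLabel s C) :=
    Fintype.sum_equiv (G.stDCircleEquiv' m ε s.state) _ _ (fun C' ↦ by rw [circleLabel_antiD])
  rw [qDegree_eq_sum_circleLabel, qDegree_eq_sum_circleLabel, hsum]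
  simp only [antiD_state, weight_stD', nPlus_antiBigon, nMinus_antiBigon]
  push_cast
  ring

end GaussDiagram

end Literature.Topology.FourManifolds
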